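import Literature.MathematicalPhysics.QuantumFieldTheory.Balaban1983to89.B9IndexBondFaithful
import Literature.MathematicalPhysics.QuantumFieldTheory.Balaban1983to89.B9PinMembersKLevelV1
import Literature.MathematicalPhysics.QuantumFieldTheory.Balaban1983to89.Node00.OpsYOfLetters

/-!
# `Balaban1983to89.Node00.OpsYBondMapOfRecord` — THE BOND MAP OF RECORD `bIOfRecord : FBondY i → IBondY i` OF STAGE 3′(Y), WITH ITS FOUR
# GEOMETRIC LAWS (carrier-faithful `hβI`, level-faithful `hlev`, 1-faithful `hβ1`, direction-blind `hbI0`) AS THEOREMS, AT EVERY MEMBER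

T. Bałaban, *Propagators and renormalization transformations for lattice gauge theories. II*, Commun. Math. Phys. **96** (1984) 223–250
[`Balaban1984PropagatorsII`, "[4]"], (2.3)–(2.4) p. 224 (the `Lʲ`-blocks; *"Λ_j also denotes the set of bonds with at least one end-point in
Λ_j"*), (2.45)–(2.46) p. 231 (`𝔅 = ⋃_j Λ_j`, the admissible bonds and the distance `d(y, y′)`); T. Bałaban, *Propagators for lattice gauge
theories in a background field*, Commun. Math. Phys. **99** (1985) 389–434 [`Balaban1985BackgroundPropagators`, "B9"], (3.41) p. 397 (the
localisation `supp h ⊂ Δ(y), y ∈ 𝔅` through which the bond-sector kernels of Sect. C–D are read block by block).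

statement-level skeleton of published theorems with citation tags; proofs where landed; nothing here is a claim about the Yang–Mills mass gap

THE POINT.  The N06 certificate of record (`Summit.….BalabanUVNodes.N06AtOpsYNuOfRecordV6EPairUD ∕ …UF`) reads def-Y's bond-sector kernels
through a BLOCK MAP ON THE FINE BONDS, displayed as a DATA binder `bI : ∀ x : MemberY …, FBondY x.toKIdx → IBondY x.toKIdx` together with FOUR
LAW binders — `hβI` (whenever the block of `f` IS a carrier block `β c`, `β (bI x f)` is the block of `f`), `hlev` (`lvl (bI x f)` = the level
of the block of `f`), `hβ1` (`d_T(β (bI x f), block of f) ≤ 1`) and `hbI0` (`bI x f = bI x ⟨f.src, 0⟩`: the map only sees the source point).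
That the five are JOINTLY INHABITED at every k-level census index is a TREE THEOREM in de-Skolemised form: dag-n06-k ∕ dag-n06-d's
`B9IndexBondFaithful.exists_faithful_dirBlind_kIdx` (and its `FBondY`-spelled twin `B9Thm31GpMajFromPinsPairM.exists_faithful_dirBlind_kIdx`).
THIS FILE is the instance owner's SKOLEMISATION of that theorem — nothing more: it NAMES one such map, `bIOfRecord i := (exists_faithful_dirBlind_kIdx
i).choose`, proves its four laws as theorems (`.choose_spec`), and lifts it to the members of Stage 3′(Y) in EXACTLY the certificate's binder
shapes (`bIYOfRecord θ Mstar : ∀ x : MemberY θ.d₆ θ.ℓ₆ θ.hd' θ.hL' θ.b₀ θ.b₁ M⋆, FBondY x.toKIdx → IBondY x.toKIdx` over NODE 00's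
`Stage3Params`, laws `bIYOfRecord_hβI ∕ _hlev ∕ _hβ1 ∕ _hbI0`, and the one-equation bundle `lawsY_of_eq`), so that a certificate ∕ face may CITE A
TERM (`«INHABITED BY: bIYOfRecord»`), INSTANTIATE `bI := bIYOfRecord θ.toStage3Params M⋆` and drop the four law binders, or keep `bI` displayed
with one equation `hbI : bI = bIYOfRecord θ.toStage3Params M⋆`.

WHY THIS FILE (pub-ymgap bus 2026-08-29: director-ym №300 ∕ №301 — the (α5) face's clause (9) `bI` + laws is a «∀-quantified structure map with
laws» species whose inhabitant must be NAMED; (c4) = «a NAMED inhabitant `bIOfRecord` (the bond inclusion FBondY → IBondY of the Stage-3′(Y)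
record) with the four laws as theorems for ALL members», pen = node00-def-Y; dag-n24-c's de-Skolemised target `exists_bI_laws` is §1's last
theorem verbatim).  No member is excluded: the tree theorem is TOTAL over every `KIdx`, so no «LOCATED» witness can arise from this clause.

WHAT THIS FILE DOES (one definition by choice + projections of `choose_spec`; no estimate; nothing of [4] ∕ [B9] asserted; nothing landed is
modified; NODE 00's letter layer does not import it):
* §1 at a k-level census index `i`: ★ `bIOfRecord i`, `bIOfRecord_hβI ∕ _hlev ∕ _hβ1 ∕ _hbI0`, the bundle `bIOfRecord_laws`, ★ `exists_bI_laws`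
  (dag-n24-c's (c4) target, conjunct order `hβI, hlev, hβ1, hbI0`);
* §2 at the members of Stage 3′(Y) (`θ : Stage3Params`, `M⋆`): ★ `bIYOfRecord θ M⋆ x := bIOfRecord x.toKIdx` (`bIYOfRecord_apply`), the four
  laws in the certificate's binder TEXTS (`bIYOfRecord_hβI ∕ _hlev ∕ _hβ1 ∕ _hbI0`), ★ `lawsY_of_eq : bI = bIYOfRecord θ M⋆ → hβI ∧ hlev ∧ hβ1 ∧
  hbI0` (binder texts and order of the certificate), `exists_bIY_laws` (the Skolemised display, inhabited).

HONEST SCOPE.  Choice over a landed combinatorial theorem of the tree's own domain datum (credit: dag-n06-k `exists_faithful_kIdx`, dag-n06-d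
`exists_faithful_dirBlind_kIdx`); DEFINITIONS + one-line lemmas; count-neutral; N06 ∕ N24 NOT discharged; one finite lattice programme; nothing
continuum, nothing about OS positivity or the mass gap.  Cell `pub-ymgap` (HUMAN RULING D-0062), unit `pub-ymgap-node00-def-Y` (g28), 2026-08-29.
-/

noncomputable section

namespace Literature.MathematicalPhysics.QuantumFieldTheory.Balaban1983to89.Node00.OpsYBondMapOfRecord

open Node00
open B6KLevelCensusIndexV1 (KIdx)
open B6GlobalChartV1 (blkV1)
open B6Ineq2142KLevelV1 (lvl β)
open B6Geom246MultiLevelTorus (geomT)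
open B9PinMembersKLevelV1 (MemberY)
open B9IndexBondFaithful (exists_faithful_dirBlind_kIdx)

variable {d ℓ : ℕ} {hd : 1 ≤ d + 1} {hL : Odd (ℓ + 1) ∧ 1 < ℓ + 1} {b₀ b₁ : ℝ}

/-! ## §1 At a k-level census index: the named map and its four laws -/

section Index

/-- ★ **THE BOND MAP OF RECORD** at a k-level census index: ONE level-faithful, carrier-faithful, 1-faithful and direction-blind block map
`fine bonds → index bonds`, chosen once and for all from the tree theorem `B9IndexBondFaithful.exists_faithful_dirBlind_kIdx` (if the block of
`f₋` is a carrier block `β c`, such a `c`; on an orphan block, an index bond of the right level one block away; constant on the `d+1` bonds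
issuing from `f₋`). [cite: Balaban1984PropagatorsII, (2.3)–(2.4) p.224, (2.45)–(2.46) p.231; Balaban1985BackgroundPropagators, (3.41) p.397] -/
def bIOfRecord (i : KIdx d ℓ hd hL b₀ b₁) : FBondY i → IBondY i :=
  (exists_faithful_dirBlind_kIdx i).choose

/-- law `hβI` (CARRIER-FAITHFUL): whenever the block of `f` is a carrier block `β c`, the chosen index bond carries that block. [cite: Balaban1984PropagatorsII, (2.45)–(2.46) p.231; Balaban1985BackgroundPropagators, (3.41) p.397] -/
theorem bIOfRecord_hβI (i : KIdx d ℓ hd hL b₀ b₁) :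
    ∀ (f : FBondY i) (c : IBondY i), blkV1 i.hN i.D f = β i.hN i.D i.hk c → β i.hN i.D i.hk (bIOfRecord i f) = blkV1 i.hN i.D f :=
  (exists_faithful_dirBlind_kIdx i).choose_spec.2.1

/-- law `hlev` (LEVEL-FAITHFUL): the chosen index bond has the level of the block of `f`. [cite: Balaban1984PropagatorsII, (2.3)–(2.4) p.224, (2.45) p.231] -/
theorem bIOfRecord_hlev (i : KIdx d ℓ hd hL b₀ b₁) :
    ∀ f, lvl i.hN i.D i.hk (bIOfRecord i f) = (blkV1 i.hN i.D f).1.1 :=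
  (exists_faithful_dirBlind_kIdx i).choose_spec.1

/-- law `hβ1` (1-FAITHFUL): the carrier block of the chosen index bond is within torus block-distance `1` of the block of `f`. [cite: Balaban1984PropagatorsII, (2.46) p.231; Balaban1985BackgroundPropagators, (3.41) p.397] -/
theorem bIOfRecord_hβ1 (i : KIdx d ℓ hd hL b₀ b₁) :
    ∀ f, (geomT i.D).dist (β i.hN i.D i.hk (bIOfRecord i f)) (blkV1 i.hN i.D f) ≤ 1 :=
  (exists_faithful_dirBlind_kIdx i).choose_spec.2.2.1

/-- law `hbI0` (DIRECTION-BLIND): the map only sees the source point, `bI f = bI ⟨f₋, e₀⟩`. [cite: Balaban1984PropagatorsII, (2.45) p.231 + p.248 («sites replaced by bonds»), bookkeeping] -/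
theorem bIOfRecord_hbI0 (i : KIdx d ℓ hd hL b₀ b₁) :
    ∀ f, bIOfRecord i f = bIOfRecord i ⟨f.src, 0⟩ :=
  (exists_faithful_dirBlind_kIdx i).choose_spec.2.2.2

/-- the four laws of `bIOfRecord i` as one conjunction, in the order `hβI, hlev, hβ1, hbI0` of the N06 certificate's binders. [cite: Balaban1984PropagatorsII, (2.3)–(2.4) p.224, (2.45)–(2.46) p.231; Balaban1985BackgroundPropagators, (3.41) p.397] -/
theorem bIOfRecord_laws (i : KIdx d ℓ hd hL b₀ b₁) :
    (∀ (f : FBondY i) (c : IBondY i), blkV1 i.hN i.D f = β i.hN i.D i.hk c → β i.hN i.D i.hk (bIOfRecord i f) = blkV1 i.hN i.D f) ∧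
    (∀ f, lvl i.hN i.D i.hk (bIOfRecord i f) = (blkV1 i.hN i.D f).1.1) ∧
    (∀ f, (geomT i.D).dist (β i.hN i.D i.hk (bIOfRecord i f)) (blkV1 i.hN i.D f) ≤ 1) ∧
    (∀ f, bIOfRecord i f = bIOfRecord i ⟨f.src, 0⟩) :=
  ⟨bIOfRecord_hβI i, bIOfRecord_hlev i, bIOfRecord_hβ1 i, bIOfRecord_hbI0 i⟩

/-- ★ **dag-n24-c's (c4) target `exists_bI_laws`, verbatim**: at every k-level census index a block map `FBondY i → IBondY i` with the four laws
exists — witnessed by the named map `bIOfRecord i` (equivalently: `B9IndexBondFaithful.exists_faithful_dirBlind_kIdx` with its first two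
conjuncts swapped). [cite: Balaban1984PropagatorsII, (2.3)–(2.4) p.224, (2.45)–(2.46) p.231; Balaban1985BackgroundPropagators, (3.41) p.397] -/
theorem exists_bI_laws (i : KIdx d ℓ hd hL b₀ b₁) :
    ∃ bI : FBondY i → IBondY i,
      (∀ (f : FBondY i) (c : IBondY i), blkV1 i.hN i.D f = β i.hN i.D i.hk c → β i.hN i.D i.hk (bI f) = blkV1 i.hN i.D f) ∧
      (∀ f, lvl i.hN i.D i.hk (bI f) = (blkV1 i.hN i.D f).1.1) ∧
      (∀ f, (geomT i.D).dist (β i.hN i.D i.hk (bI f)) (blkV1 i.hN i.D f) ≤ 1) ∧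
      (∀ f, bI f = bI ⟨f.src, 0⟩) :=
  ⟨bIOfRecord i, bIOfRecord_laws i⟩

end Index

/-! ## §2 At the members of Stage 3′(Y): the certificate's binder shapes -/

section Members

variable (θ : Stage3Params) (Mstar : ℕ)

/-- ★ **THE BOND MAP OF RECORD AT THE MEMBERS OF STAGE 3′(Y)**: `bIYOfRecord θ M⋆ x := bIOfRecord x.toKIdx` — the partial application
`bIYOfRecord θ M⋆` has EXACTLY the type `∀ x : MemberY θ.d₆ θ.ℓ₆ θ.hd' θ.hL' θ.b₀ θ.b₁ M⋆, FBondY x.toKIdx → IBondY x.toKIdx` of the N06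
certificate's data binder `bI` (there `θ` is the certificate's `θ.toStage3Params`). [cite: Balaban1984PropagatorsII, (2.3)–(2.4) p.224, (2.45)–(2.46) p.231; Balaban1985BackgroundPropagators, (3.41) p.397] -/
def bIYOfRecord (x : MemberY θ.d₆ θ.ℓ₆ θ.hd' θ.hL' θ.b₀ θ.b₁ Mstar) : FBondY x.toKIdx → IBondY x.toKIdx :=
  bIOfRecord x.toKIdx

/-- `bIYOfRecord θ M⋆ x` IS `bIOfRecord x.toKIdx`. [cite: Balaban1984PropagatorsII, (2.45) p.231, bookkeeping] -/
theorem bIYOfRecord_apply (x : MemberY θ.d₆ θ.ℓ₆ θ.hd' θ.hL' θ.b₀ θ.b₁ Mstar) : bIYOfRecord θ Mstar x = bIOfRecord x.toKIdx := rfl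

/-- law `hβI` at the members, in the certificate's binder text. [cite: Balaban1984PropagatorsII, (2.45)–(2.46) p.231; Balaban1985BackgroundPropagators, (3.41) p.397] -/
theorem bIYOfRecord_hβI :
    ∀ (x : MemberY θ.d₆ θ.ℓ₆ θ.hd' θ.hL' θ.b₀ θ.b₁ Mstar) (f : FBondY x.toKIdx) (c : IBondY x.toKIdx),
      blkV1 x.hN x.D f = β x.hN x.D x.hk c → β x.hN x.D x.hk (bIYOfRecord θ Mstar x f) = blkV1 x.hN x.D f :=
  fun x => bIOfRecord_hβI x.toKIdx

/-- law `hlev` at the members, in the certificate's binder text. [cite: Balaban1984PropagatorsII, (2.3)–(2.4) p.224, (2.45) p.231] -/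
theorem bIYOfRecord_hlev :
    ∀ (x : MemberY θ.d₆ θ.ℓ₆ θ.hd' θ.hL' θ.b₀ θ.b₁ Mstar) (f : FBondY x.toKIdx),
      lvl x.hN x.D x.hk (bIYOfRecord θ Mstar x f) = (blkV1 x.hN x.D f).1.1 :=
  fun x => bIOfRecord_hlev x.toKIdx

/-- law `hβ1` at the members, in the certificate's binder text. [cite: Balaban1984PropagatorsII, (2.46) p.231; Balaban1985BackgroundPropagators, (3.41) p.397] -/
theorem bIYOfRecord_hβ1 :
    ∀ (x : MemberY θ.d₆ θ.ℓ₆ θ.hd' θ.hL' θ.b₀ θ.b₁ Mstar) (f : FBondY x.toKIdx),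
      (geomT x.D).dist (β x.hN x.D x.hk (bIYOfRecord θ Mstar x f)) (blkV1 x.hN x.D f) ≤ 1 :=
  fun x => bIOfRecord_hβ1 x.toKIdx

/-- law `hbI0` at the members, in the certificate's binder text. [cite: Balaban1984PropagatorsII, (2.45) p.231 + p.248, bookkeeping] -/
theorem bIYOfRecord_hbI0 :
    ∀ (x : MemberY θ.d₆ θ.ℓ₆ θ.hd' θ.hL' θ.b₀ θ.b₁ Mstar) (f : FBondY x.toKIdx),
      bIYOfRecord θ Mstar x f = bIYOfRecord θ Mstar x ⟨f.src, 0⟩ :=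
  fun x => bIOfRecord_hbI0 x.toKIdx

variable {θ Mstar}

/-- ★ **THE FOUR LAW BINDERS FROM ONE EQUATION**: if the certificate's `bI` is pinned by `hbI : bI = bIYOfRecord θ M⋆`, its law binders
`hβI hlev hβ1 hbI0` hold — in the certificate's binder TEXTS and ORDER (`obtain ⟨hβI, hlev, hβ1, hbI0⟩ := lawsY_of_eq hbI`).
[cite: Balaban1984PropagatorsII, (2.3)–(2.4) p.224, (2.45)–(2.46) p.231; Balaban1985BackgroundPropagators, (3.41) p.397] -/
theorem lawsY_of_eq {bI : ∀ x : MemberY θ.d₆ θ.ℓ₆ θ.hd' θ.hL' θ.b₀ θ.b₁ Mstar, FBondY x.toKIdx → IBondY x.toKIdx}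
    (hbI : bI = bIYOfRecord θ Mstar) :
    (∀ (x : MemberY θ.d₆ θ.ℓ₆ θ.hd' θ.hL' θ.b₀ θ.b₁ Mstar) (f : FBondY x.toKIdx) (c : IBondY x.toKIdx),
        blkV1 x.hN x.D f = β x.hN x.D x.hk c → β x.hN x.D x.hk (bI x f) = blkV1 x.hN x.D f) ∧
    (∀ (x : MemberY θ.d₆ θ.ℓ₆ θ.hd' θ.hL' θ.b₀ θ.b₁ Mstar) (f : FBondY x.toKIdx), lvl x.hN x.D x.hk (bI x f) = (blkV1 x.hN x.D f).1.1) ∧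
    (∀ (x : MemberY θ.d₆ θ.ℓ₆ θ.hd' θ.hL' θ.b₀ θ.b₁ Mstar) (f : FBondY x.toKIdx),
        (geomT x.D).dist (β x.hN x.D x.hk (bI x f)) (blkV1 x.hN x.D f) ≤ 1) ∧
    (∀ (x : MemberY θ.d₆ θ.ℓ₆ θ.hd' θ.hL' θ.b₀ θ.b₁ Mstar) (f : FBondY x.toKIdx), bI x f = bI x ⟨f.src, 0⟩) := by
  subst hbI
  exact ⟨bIYOfRecord_hβI θ Mstar, bIYOfRecord_hlev θ Mstar, bIYOfRecord_hβ1 θ Mstar, bIYOfRecord_hbI0 θ Mstar⟩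

variable (θ Mstar)

/-- the certificate's DISPLAY `bI hβI hlev hβ1 hbI0` (Skolemised over the members of Stage 3′(Y)) IS INHABITED — by `bIYOfRecord θ M⋆`.
[cite: Balaban1984PropagatorsII, (2.3)–(2.4) p.224, (2.45)–(2.46) p.231; Balaban1985BackgroundPropagators, (3.41) p.397] -/
theorem exists_bIY_laws :
    ∃ bI : ∀ x : MemberY θ.d₆ θ.ℓ₆ θ.hd' θ.hL' θ.b₀ θ.b₁ Mstar, FBondY x.toKIdx → IBondY x.toKIdx,
      (∀ (x : MemberY θ.d₆ θ.ℓ₆ θ.hd' θ.hL' θ.b₀ θ.b₁ Mstar) (f : FBondY x.toKIdx) (c : IBondY x.toKIdx),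
          blkV1 x.hN x.D f = β x.hN x.D x.hk c → β x.hN x.D x.hk (bI x f) = blkV1 x.hN x.D f) ∧
      (∀ (x : MemberY θ.d₆ θ.ℓ₆ θ.hd' θ.hL' θ.b₀ θ.b₁ Mstar) (f : FBondY x.toKIdx), lvl x.hN x.D x.hk (bI x f) = (blkV1 x.hN x.D f).1.1) ∧
      (∀ (x : MemberY θ.d₆ θ.ℓ₆ θ.hd' θ.hL' θ.b₀ θ.b₁ Mstar) (f : FBondY x.toKIdx),
          (geomT x.D).dist (β x.hN x.D x.hk (bI x f)) (blkV1 x.hN x.D f) ≤ 1) ∧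
      (∀ (x : MemberY θ.d₆ θ.ℓ₆ θ.hd' θ.hL' θ.b₀ θ.b₁ Mstar) (f : FBondY x.toKIdx), bI x f = bI x ⟨f.src, 0⟩) :=
  ⟨bIYOfRecord θ Mstar, lawsY_of_eq rfl⟩

end Members

end Literature.MathematicalPhysics.QuantumFieldTheory.Balaban1983to89.Node00.OpsYBondMapOfRecord
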